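import Literature.Geometry.Lorentzian.LinearChargeConservation
import Literature.Analysis.FluidPDE.SphereIntegral
import HarnessLib

/-!
# The averaged charges as radial averages of sphere fluxes (Mao–Oh–Tao 2023, (1.7))

Y. Mao, S.-J. Oh, Z. Tao, arXiv:2308.13031 [MaoOhTao2023], §1.2: the charges `E, P_i, C_k, J_k` of a pair `(g, k)` are
sphere fluxes ((1.3)–(1.6), `∫_{∂B_r} (…) ν^j dS`), and their averaged versions over the dyadic annulus `A_r` are
`Q[(g,k); A_r] = ∫ η_r(r′) Q[(g,k); ∂B_{r′}] dr′` ((1.7)).  The tree states the averaged charges directly as VOLUME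
integrals against the radial weight `η_r(|x|) = r⁻¹ η(|x|/r)` (`MaoOhTao.avgE/avgP/avgC/avgJ` in
`ObstructionFreeGluing.lean`); this file proves that the two agree, by polar coordinates on `ℝ³`
(`Literature.Analysis.FluidPDE.integral_eq_integral_Ioi_sphereIntegral`: `∫ f = ∫_{s>0} s² ∫_{S²} f(sα) dσ(α) ds` with
`σ = volume.toSphere`, the surface measure of the unit sphere, total mass `4π`):

* `integrable_wt_mul_flux` — the weighted flux integrands are integrable (via the gradient form of
  `LinearChargeConservation.lean`);
* `integral_wt_mul_eq_integral_Ioi_sphereIntegral` — `∫ η_r(|x|) G = ∫_{s>0} η_r(s) s² ∫_{S²} G(sα) dσ ds`;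
* `avgE_eq_integral_Ioi`, `avgP_eq_integral_Ioi`, `avgC_eq_integral_Ioi`, `avgJ_eq_integral_Ioi` — the four averaged
  charges as `∫_{s>0} η_r(s) Q[∂B_s] ds` with the sphere fluxes `Q[∂B_s] = s² ∫_{S²} (flux of (1.3)–(1.6))(sα) dσ(α)`
  written out (`ν^j = x^j/|x| = α^j`).

Everything is proved; no definitions, no named facts.  Regularity: `g ∈ C¹`, `k ∈ C⁰` (the charges involve `∂g` and
`k`).

## References

* Y. Mao, S.-J. Oh, Z. Tao, arXiv:2308.13031 (2023), §1.2, (1.3)–(1.7). [MaoOhTao2023]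
-/

noncomputable section

namespace Literature.Geometry.Lorentzian

namespace MaoOhTao

open scoped _root_.Manifold _root_.ContDiff BigOperators _root_.Topology
open _root_.MeasureTheory _root_.Filter _root_.Set intervalIntegral
open Literature.Analysis.FluidPDE

variable {η : ℝ → ℝ} {r : ℝ} {g k : E3 → E3 →L[ℝ] E3 →L[ℝ] ℝ}

/-- The weighted flux integrands `η_r(|x|) Σ_j F_j(x) x^j/|x|` of the averaged charges are integrable on `ℝ³` for
continuous fluxes (they are the continuous, compactly supported functions `Σ_j ∂_j χ_r(|x|) F_j(x)`,
`wt_mul_sum_eq_sum_fderiv_mul`). [folklore] -/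
theorem integrable_wt_mul_flux (hη : IsBump η) (hr : 0 < r) {F : Fin 3 → E3 → ℝ}
    (hF : ∀ j, Continuous (F j)) :
    Integrable fun x : E3 ↦ wt η r x * ∑ j, F j x * (x j / ‖x‖) := by
  have hψa : ∀ t, t ≤ r → r⁻¹ * η (t / r) = 0 := fun t ht ↦ wt1_eq_zero_of_le hη hr ht
  have heq : (fun x : E3 ↦ wt η r x * ∑ j, F j x * (x j / ‖x‖)) = fun x ↦
      ∑ j, fderiv ℝ (fun y : E3 ↦ ∫ t in (0:ℝ)..‖y‖, r⁻¹ * η (t / r)) x (e j) * F j x :=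
    funext fun x ↦ wt_mul_sum_eq_sum_fderiv_mul hη hr hψa F x
  rw [heq]
  exact integrable_finsetSum _ fun j _ ↦ integrable_fderiv_radialPrimitive_mul hη hr hr hψa (hF j) j

/-- **Radial weights integrate sphere averages** (polar coordinates on `ℝ³`): for an integrable weighted integrand,
`∫ η_r(|x|) G(x) dx = ∫_0^∞ η_r(s) · s² (∫_{S²} G(s α) dσ(α)) ds` with `σ = volume.toSphere` the surface measure of the
unit sphere (`Literature.Analysis.FluidPDE.integral_eq_integral_Ioi_sphereIntegral`), `η_r` being constant on spheres.
This is the identity `∫ η_r(|x|) (…) dx = ∫ η_r(r′) Q[∂B_{r′}] dr′` behind the rendering of Mao–Oh–Tao's (1.7) as volume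
integrals in `ObstructionFreeGluing.lean`. [cite: MaoOhTao2023, §1.2 (1.7)] -/
theorem integral_wt_mul_eq_integral_Ioi_sphereIntegral (η : ℝ → ℝ) {r : ℝ} {G : E3 → ℝ}
    (hG : Integrable fun x : E3 ↦ wt η r x * G x) :
    ∫ x : E3, wt η r x * G x =
      ∫ s in Ioi (0:ℝ), (r⁻¹ * η (s / r)) * (s ^ 2 * sphereIntegral (volume : Measure E3) G s) := by
  rw [integral_eq_integral_Ioi_sphereIntegral (volume : Measure E3) hG]
  refine setIntegral_congr_fun measurableSet_Ioi fun s hs ↦ ?_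
  have hs' : 0 ≤ s := le_of_lt hs
  have hdim : Module.finrank ℝ E3 - 1 = 2 := by
    rw [finrank_euclideanSpace_fin]
  rw [hdim, smul_eq_mul, sphereIntegral_def, sphereIntegral_def]
  have hpt : ∀ α : Metric.sphere (0 : E3) 1, wt η r (s • (α : E3)) * G (s • (α : E3)) =
      (r⁻¹ * η (s / r)) * G (s • (α : E3)) := by
    intro α
    rw [wt, norm_smul_sphere hs' α]
  simp_rw [hpt, _root_.MeasureTheory.integral_const_mul]
  ring

/-- **The averaged energy is the `η_r`-average of the sphere energies** (Mao–Oh–Tao (1.3) with (1.7)):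
`avgE η r g = ∫_0^∞ η_r(s) E[g; ∂B_s] ds` with `E[g; ∂B_s] = ½ s² ∫_{S²} Σ_{i,j} (∂_i g_{ij} − ∂_j g_{ii})(sα) α^j dσ(α)`
(`x^j/|x| = α^j` on the sphere of radius `s`), for a `C¹` coefficient field `g`. [cite: MaoOhTao2023, §1.2 (1.3), (1.7)] -/
theorem avgE_eq_integral_Ioi (hη : IsBump η) (hr : 0 < r) (hg : ContDiff ℝ 1 g) :
    avgE η r g = (1 / 2) * ∫ s in Ioi (0:ℝ), (r⁻¹ * η (s / r)) * (s ^ 2 *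
      sphereIntegral (volume : Measure E3)
        (fun x : E3 ↦ ∑ i, ∑ j, (pd i (cmp g i j) x - pd j (cmp g i i) x) * (x j / ‖x‖)) s) := by
  unfold avgE
  congr 1
  have hpd : ∀ i j l, Continuous (pd l (cmp g i j)) := fun i j l ↦
    (contDiff_pd (n := 0) (contDiff_cmp hg i j) l).continuous
  have hint : Integrable fun x : E3 ↦
      wt η r x * ∑ i, ∑ j, (pd i (cmp g i j) x - pd j (cmp g i i) x) * (x j / ‖x‖) := by
    have h := integrable_wt_mul_flux hη hr
      (F := fun j x ↦ ∑ i, (pd i (cmp g i j) x - pd j (cmp g i i) x))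
      fun j ↦ continuous_finsetSum _ fun i _ ↦ (hpd i j i).sub (hpd i i j)
    refine h.congr (Eventually.of_forall fun x ↦ ?_)
    simp only [Finset.sum_mul]
    rw [Finset.sum_comm]
  exact integral_wt_mul_eq_integral_Ioi_sphereIntegral η hint

/-- The components of a continuous coefficient field are continuous. [folklore] -/
theorem continuous_cmp (hk : Continuous k) (i j : Fin 3) : Continuous (cmp k i j) := by
  unfold cmp
  exact (hk.clm_apply continuous_const).clm_apply continuous_const

/-- The Euclidean trace of a continuous coefficient field is continuous. [folklore] -/
theorem continuous_trδ (hk : Continuous k) : Continuous (trδ k) := by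
  unfold trδ
  exact continuous_finsetSum _ fun i _ ↦ continuous_cmp hk i i

/-- **The averaged linear momentum is the `η_r`-average of the sphere momenta** (Mao–Oh–Tao (1.4) with (1.7)):
`avgP η r k l = ∫_0^∞ η_r(s) P_l[k; ∂B_s] ds`, `P_l[k; ∂B_s] = s² ∫_{S²} Σ_j (k_{lj} − δ_{lj} tr_δ k)(sα) α^j dσ(α)`, for a
continuous coefficient field `k`. [cite: MaoOhTao2023, §1.2 (1.4), (1.7)] -/
theorem avgP_eq_integral_Ioi (hη : IsBump η) (hr : 0 < r) (hk : Continuous k) (l : Fin 3) :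
    avgP η r k l = ∫ s in Ioi (0:ℝ), (r⁻¹ * η (s / r)) * (s ^ 2 *
      sphereIntegral (volume : Measure E3)
        (fun x : E3 ↦ ∑ j, (cmp k l j x - (if l = j then trδ k x else 0)) * (x j / ‖x‖)) s) := by
  unfold avgP
  have hF : ∀ j, Continuous fun x : E3 ↦ cmp k l j x - (if l = j then trδ k x else 0) := by
    intro j
    by_cases h : l = j
    · simp only [h, if_true]; exact (continuous_cmp hk j j).sub (continuous_trδ hk)
    · simp only [h, if_false, sub_zero]; exact continuous_cmp hk l j
  exact integral_wt_mul_eq_integral_Ioi_sphereIntegral η (integrable_wt_mul_flux hη hr hF)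

/-- **The averaged centre of mass is the `η_r`-average of the sphere charges** (Mao–Oh–Tao (1.5) with (1.7)):
`avgC η r g l = ∫_0^∞ η_r(s) C_l[g; ∂B_s] ds`, `C_l[g; ∂B_s] = ½ s² ∫_{S²} Σ_{i,j} (x_l ∂_i g_{ij} − x_l ∂_j g_{ii}
− δ_{il}(g_{ij} − δ_{ij}) + δ_{jl}(g_{ii} − δ_{ii}))(sα) α^j dσ(α)`, for a `C¹` coefficient field `g`.
[cite: MaoOhTao2023, §1.2 (1.5), (1.7)] -/
theorem avgC_eq_integral_Ioi (hη : IsBump η) (hr : 0 < r) (hg : ContDiff ℝ 1 g) (l : Fin 3) :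
    avgC η r g l = (1 / 2) * ∫ s in Ioi (0:ℝ), (r⁻¹ * η (s / r)) * (s ^ 2 *
      sphereIntegral (volume : Measure E3)
        (fun x : E3 ↦ ∑ i, ∑ j, (x l * pd i (cmp g i j) x - x l * pd j (cmp g i i) x
          - (if i = l then cmp g i j x - (if i = j then 1 else 0) else 0)
          + (if j = l then cmp g i i x - 1 else 0)) * (x j / ‖x‖)) s) := by
  unfold avgC
  congr 1
  have hpd : ∀ i j m, Continuous (pd m (cmp g i j)) := fun i j m ↦
    (contDiff_pd (n := 0) (contDiff_cmp hg i j) m).continuous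
  have hcmp : ∀ i j, Continuous (cmp g i j) := fun i j ↦ continuous_cmp hg.continuous i j
  have hF : ∀ j, Continuous fun x : E3 ↦ ∑ i, (x l * pd i (cmp g i j) x - x l * pd j (cmp g i i) x
      - (if i = l then cmp g i j x - (if i = j then 1 else 0) else 0)
      + (if j = l then cmp g i i x - 1 else 0)) := by
    intro j
    refine continuous_finsetSum _ fun i _ ↦ ?_
    have hc : Continuous fun x : E3 ↦ x l := (EuclideanSpace.proj (𝕜 := ℝ) l).continuous
    have h1 : Continuous fun x : E3 ↦ x l * pd i (cmp g i j) x - x l * pd j (cmp g i i) x :=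
      (hc.mul (hpd i j i)).sub (hc.mul (hpd i i j))
    have h2 : Continuous fun x : E3 ↦ (if i = l then cmp g i j x - (if i = j then 1 else 0) else 0) := by
      by_cases h : i = l
      · simp only [h, if_true]; exact (hcmp l j).sub continuous_const
      · simp only [h, if_false]; exact continuous_const
    have h3 : Continuous fun x : E3 ↦ (if j = l then cmp g i i x - 1 else 0) := by
      by_cases h : j = l
      · simp only [h, if_true]; exact (hcmp i i).sub continuous_const
      · simp only [h, if_false]; exact continuous_const
    exact (h1.sub h2).add h3
  have hint := integrable_wt_mul_flux hη hr hF
  have hint' : Integrable fun x : E3 ↦ wt η r x * ∑ i, ∑ j,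
      (x l * pd i (cmp g i j) x - x l * pd j (cmp g i i) x
        - (if i = l then cmp g i j x - (if i = j then 1 else 0) else 0)
        + (if j = l then cmp g i i x - 1 else 0)) * (x j / ‖x‖) := by
    refine hint.congr (Eventually.of_forall fun x ↦ ?_)
    simp only [Finset.sum_mul]
    rw [Finset.sum_comm]
  exact integral_wt_mul_eq_integral_Ioi_sphereIntegral η hint'

/-- **The averaged angular momentum is the `η_r`-average of the sphere charges** (Mao–Oh–Tao (1.6) with (1.7)):
`avgJ η r k l = ∫_0^∞ η_r(s) J_l[k; ∂B_s] ds`, `J_l[k; ∂B_s] = s² ∫_{S²} Σ_{i,j} (k_{ij} − δ_{ij} tr_δ k) Y_l^i α^j (sα) dσ(α)`,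
for a continuous coefficient field `k`. [cite: MaoOhTao2023, §1.2 (1.6), (1.7)] -/
theorem avgJ_eq_integral_Ioi (hη : IsBump η) (hr : 0 < r) (hk : Continuous k) (l : Fin 3) :
    avgJ η r k l = ∫ s in Ioi (0:ℝ), (r⁻¹ * η (s / r)) * (s ^ 2 *
      sphereIntegral (volume : Measure E3)
        (fun x : E3 ↦ ∑ i, ∑ j, (cmp k i j x - (if i = j then trδ k x else 0)) * rotGen l x i *
          (x j / ‖x‖)) s) := by
  unfold avgJ
  have hF : ∀ j, Continuous fun x : E3 ↦ ∑ i, (cmp k i j x - (if i = j then trδ k x else 0)) *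
      rotGen l x i := by
    intro j
    refine continuous_finsetSum _ fun i _ ↦ ?_
    have h1 : Continuous fun x : E3 ↦ cmp k i j x - (if i = j then trδ k x else 0) := by
      by_cases h : i = j
      · subst h
        simp only [if_true]; exact (continuous_cmp hk i i).sub (continuous_trδ hk)
      · simp only [h, if_false, sub_zero]; exact continuous_cmp hk i j
    exact h1.mul (contDiff_rotGen (n := 0) l i).continuous
  have hint := integrable_wt_mul_flux hη hr hF
  have hint' : Integrable fun x : E3 ↦ wt η r x * ∑ i, ∑ j,
      (cmp k i j x - (if i = j then trδ k x else 0)) * rotGen l x i * (x j / ‖x‖) := by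
    refine hint.congr (Eventually.of_forall fun x ↦ ?_)
    simp only [Finset.sum_mul]
    rw [Finset.sum_comm]
  exact integral_wt_mul_eq_integral_Ioi_sphereIntegral η hint'

end MaoOhTao

end Literature.Geometry.Lorentzian

end
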